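import Mathlib.FieldTheory.PrimitiveElement
import Mathlib.NumberTheory.NumberField.InfinitePlace.Embeddings
import Mathlib.LinearAlgebra.FiniteDimensional.Lemmas
import Mathlib.LinearAlgebra.Eigenspace.Basic
import Mathlib.LinearAlgebra.TensorProduct.Tower
import Mathlib.RingTheory.TensorProduct.Free
import HarnessLib

/-!
# COR-CM model facts, exterior-algebra group: the eigenbasis of the complexified rational `H¹` of a
# CM factor (linear algebra for model axiom M15 `Fact_weilLine_rank`)

HONEST FRAMING (cell pub-hodgecm2 / COR-CM): pure linear algebra; nothing about algebraic cycles.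

Setting (the shape in which the stage-1 package `HodgeCMPerL` reads a CM abelian variety `A_{(K,Φ)}`
of its geometric universe, `HodgeCM/Geometry/Universe.lean`: `cmAct`, `eigenLine`; model axioms M12
`Fact_eigenLine`, M22 `Fact_H1_rank` of `HodgeCM/Geometry/Facts.lean`): a number field `K` acting on a
finite-dimensional `ℚ`-vector space `V` (think `V = H¹(A, ℚ)`) by a `ℚ`-algebra map
`ι : K →ₐ[ℚ] End_ℚ V`, such that

* (M12 shape) every joint `σ`-eigenspace `V_σ := ⋂ₑ ker((ι e) ⊗ ℂ − σ(e))` of the complexified action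
  on `ℂ ⊗_ℚ V`, `σ : K → ℂ` an embedding, is a LINE;
* (M22 shape) `dim_ℚ V = [K:ℚ]`.

PROVED here (Deligne, LNM 900, §4–5; Shimura 1998 §3.2: `H¹(A, ℂ) = ⊕_σ H¹_σ` with one-dimensional
summands when `[K:ℚ] = 2 dim A`):
* `iSupIndep_eigenLine` — the `V_σ` of distinct embeddings are independent (a power-basis generator of
  `K/ℚ` separates the embeddings; eigenspaces of one operator for distinct eigenvalues are independent);
* `exists_eigenBasis` — there is a `ℂ`-basis `ℓ : (K → ℂ) → ℂ ⊗ V` of `ℂ ⊗_ℚ V` with `ℓ σ ∈ V_σ`, and then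
  every element of `V_σ` is a multiple of `ℓ σ` (`eq_smul_of_mem_eigenLine`);
* `baseChange_ι_apply_eigen` — `(ι e ⊗ ℂ) x = σ(e) • x` on `V_σ`;
* `exists_eq_ι_apply` — `V` is a LINE over `K`: for `u ≠ 0` every `v ∈ V` is `ι(e) u` for some `e ∈ K`
  (the map `e ↦ ι(e) u` is an injective `ℚ`-linear map between spaces of equal dimension);
* `repr_one_tmul_ne_zero` — for `u ≠ 0` EVERY coordinate of `1 ⊗ u` in an eigenbasis is non-zero
  (otherwise `1 ⊗ V = 1 ⊗ K·u` would lie in the span of the other eigenvectors).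

## References
* [Deligne1982HodgeCycles] P. Deligne, *Hodge cycles on abelian varieties*, LNM 900 (1982), §4–5.
* [Shimura1998] G. Shimura, *Abelian Varieties with Complex Multiplication and Modular Functions*
  (1998), §3.2, §5.2.
-/

noncomputable section

open scoped TensorProduct
open Module

namespace Summit.HodgeConjecture.CorCM.Model

section EigenBasis

variable {K : Type} [Field K] [NumberField K]
variable {V : Type*} [AddCommGroup V] [Module ℚ V]
variable (ι : K →ₐ[ℚ] Module.End ℚ V)

/-- The joint `σ`-eigenspace of the complexified action (the package's `Universe.eigenLine`, unfolded):
`V_σ = ⋂ₑ ker((ι e) ⊗ ℂ − σ(e))`. Local notation only (no definition is introduced). -/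
local notation3 (prettyPrint := false) "EigLine[" ι ", " σ "]" =>
  (⨅ e : K, Module.End.eigenspace (LinearMap.baseChange ℂ (ι e)) (σ e) : Submodule ℂ (ℂ ⊗[ℚ] V))

/-- Membership in the joint eigenspace, unfolded. [folklore] -/
theorem mem_eigenLine_iff (σ : K →+* ℂ) (x : ℂ ⊗[ℚ] V) :
    x ∈ EigLine[ι, σ] ↔ ∀ e : K, (ι e).baseChange ℂ x = σ e • x := by
  simp only [Submodule.mem_iInf, Module.End.mem_eigenspace_iff]

/-- On `V_σ` the complexified action of `e` is multiplication by `σ(e)`. [folklore] -/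
theorem baseChange_ι_apply_eigen {σ : K →+* ℂ} {x : ℂ ⊗[ℚ] V} (hx : x ∈ EigLine[ι, σ]) (e : K) :
    (ι e).baseChange ℂ x = σ e • x :=
  (mem_eigenLine_iff ι σ x).1 hx e

/-- **The joint eigenspaces of distinct embeddings are independent**: a power-basis generator `γ` of
`K/ℚ` separates the embeddings `K → ℂ` (`PowerBasis.algHom_ext`), `V_σ` lies in the `σ(γ)`-eigenspace
of `(ι γ) ⊗ ℂ`, and eigenspaces of one endomorphism for distinct eigenvalues are independent
(`Module.End.eigenspaces_iSupIndep`). Same argument as the tree's `PicardCM.iSupIndep_eigenline`.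
[cite: Deligne1982HodgeCycles, §4] -/
theorem iSupIndep_eigenLine : iSupIndep fun σ : K →+* ℂ ↦ EigLine[ι, σ] := by
  classical
  let pb := Field.powerBasisOfFiniteOfSeparable ℚ K
  have hinj : Function.Injective fun τ : K →+* ℂ ↦ τ pb.gen := by
    intro τ τ' hτ
    have h : τ.toRatAlgHom = τ'.toRatAlgHom :=
      pb.algHom_ext (by simpa only [RingHom.toRatAlgHom_apply] using hτ)
    exact RingHom.equivRatAlgHom.injective h
  have hind : iSupIndep ((Module.End.eigenspace ((ι pb.gen).baseChange ℂ)) ∘ fun τ : K →+* ℂ ↦ τ pb.gen) :=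
    (Module.End.eigenspaces_iSupIndep ((ι pb.gen).baseChange ℂ)).comp hinj
  exact hind.mono fun τ ↦
    iInf_le (fun a : K ↦ Module.End.eigenspace ((ι a).baseChange ℂ) (τ a)) pb.gen

variable [FiniteDimensional ℚ V]

/-- `dim_ℂ (ℂ ⊗_ℚ V) = dim_ℚ V`. [folklore] -/
theorem finrank_complexified : Module.finrank ℂ (ℂ ⊗[ℚ] V) = Module.finrank ℚ V :=
  Module.finrank_baseChange

/-- **Eigenbasis.** If every joint eigenspace `V_σ` is a line (M12 shape) and `dim_ℚ V = [K:ℚ]` (M22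
shape), then `ℂ ⊗_ℚ V` has a `ℂ`-basis `ℓ` indexed by the embeddings `σ : K → ℂ` with `ℓ σ ∈ V_σ`
(Shimura 1998 §3.2: `H¹(A, ℂ) = ⊕_σ H¹(A, ℂ)_σ`). [cite: Shimura1998, §3.2] [cite: Deligne1982HodgeCycles, §4] -/
theorem exists_eigenBasis
    (hline : ∀ σ : K →+* ℂ, Module.finrank ℂ ↥(EigLine[ι, σ]) = 1)
    (hrk : Module.finrank ℚ V = Module.finrank ℚ K) :
    ∃ ℓ : Basis (K →+* ℂ) ℂ (ℂ ⊗[ℚ] V), ∀ σ, ℓ σ ∈ EigLine[ι, σ] := by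
  -- a non-zero vector in each line
  have hex : ∀ σ : K →+* ℂ, ∃ x : ℂ ⊗[ℚ] V, x ∈ EigLine[ι, σ] ∧ x ≠ 0 := by
    intro σ
    have hpos : 0 < Module.finrank ℂ ↥(EigLine[ι, σ]) := by rw [hline σ]; exact Nat.one_pos
    obtain ⟨⟨x, hx⟩, hx0⟩ := Module.finrank_pos_iff_exists_ne_zero.1 hpos
    exact ⟨x, hx, fun h ↦ hx0 (Subtype.ext h)⟩
  choose x hxmem hx0 using hex
  have hli : LinearIndependent ℂ x :=
    (iSupIndep_eigenLine ι).linearIndependent _ hxmem hx0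
  have hcard : Fintype.card (K →+* ℂ) = Module.finrank ℂ (ℂ ⊗[ℚ] V) := by
    rw [finrank_complexified, hrk, NumberField.Embeddings.card]
  exact ⟨basisOfLinearIndependentOfCardEqFinrank hli hcard, fun σ ↦ by
    rw [coe_basisOfLinearIndependentOfCardEqFinrank]; exact hxmem σ⟩

omit [FiniteDimensional ℚ V] in
/-- With an eigenbasis `ℓ`, every element of the line `V_σ` is a multiple of `ℓ σ`. [folklore] -/
theorem eq_smul_of_mem_eigenLine
    (hline : ∀ σ : K →+* ℂ, Module.finrank ℂ ↥(EigLine[ι, σ]) = 1)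
    (ℓ : Basis (K →+* ℂ) ℂ (ℂ ⊗[ℚ] V)) (hℓ : ∀ σ, ℓ σ ∈ EigLine[ι, σ])
    (σ : K →+* ℂ) {y : ℂ ⊗[ℚ] V} (hy : y ∈ EigLine[ι, σ]) : ∃ t : ℂ, y = t • ℓ σ := by
  have h1 := (finrank_eq_one_iff_of_nonzero' (⟨ℓ σ, hℓ σ⟩ : ↥(EigLine[ι, σ]))
    (fun h ↦ ℓ.ne_zero σ (congrArg Subtype.val h))).1 (hline σ) ⟨y, hy⟩
  obtain ⟨t, ht⟩ := h1
  exact ⟨t, by simpa using (congrArg Subtype.val ht).symm⟩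

omit [FiniteDimensional ℚ V] in
/-- The eigenbasis DIAGONALISES the action: in coordinates, `repr ((ι e ⊗ ℂ) x) τ = τ(e) · repr x τ`.
[folklore] -/
theorem repr_baseChange_ι_apply (ℓ : Basis (K →+* ℂ) ℂ (ℂ ⊗[ℚ] V)) (hℓ : ∀ σ, ℓ σ ∈ EigLine[ι, σ])
    (e : K) (x : ℂ ⊗[ℚ] V) (τ : K →+* ℂ) :
    ℓ.repr ((ι e).baseChange ℂ x) τ = τ e * ℓ.repr x τ := by
  have key : (ℓ.coord τ) ∘ₗ (ι e).baseChange ℂ = τ e • ℓ.coord τ := by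
    refine ℓ.ext fun σ ↦ ?_
    rw [LinearMap.comp_apply, baseChange_ι_apply_eigen ι (hℓ σ) e, map_smul, LinearMap.smul_apply]
    change σ e • ℓ.repr (ℓ σ) τ = τ e • ℓ.repr (ℓ σ) τ
    rw [ℓ.repr_self]
    by_cases h : σ = τ
    · subst h; simp
    · simp [h]
  have := congrArg (fun f : ℂ ⊗[ℚ] V →ₗ[ℂ] ℂ ↦ f x) key
  simpa only [LinearMap.comp_apply, Basis.coord_apply, LinearMap.smul_apply, smul_eq_mul] using this

/-- **`V` is a line over `K`**: if `dim_ℚ V = [K:ℚ]` then for every `u ≠ 0` the `ℚ`-linear map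
`e ↦ ι(e) u : K → V` is bijective (injective because `K` is a field; then dimensions), so every `v ∈ V`
is `ι(e) u` for a unique `e`. [cite: Shimura1998, §5.2] -/
theorem exists_eq_ι_apply (hrk : Module.finrank ℚ V = Module.finrank ℚ K) {u : V} (hu : u ≠ 0)
    (v : V) : ∃ e : K, v = ι e u := by
  let L : K →ₗ[ℚ] V := (LinearMap.applyₗ u) ∘ₗ ι.toLinearMap
  have hL : ∀ e, L e = ι e u := fun e ↦ rfl
  have hinj : Function.Injective L := by
    rw [← LinearMap.ker_eq_bot, Submodule.eq_bot_iff]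
    intro e he
    rw [LinearMap.mem_ker, hL] at he
    by_contra hne
    apply hu
    calc u = ι (e⁻¹ * e) u := by rw [inv_mul_cancel₀ hne, map_one, Module.End.one_apply]
      _ = ι e⁻¹ (ι e u) := by rw [map_mul, Module.End.mul_apply]
      _ = 0 := by rw [he, map_zero]
  have hsurj : Function.Surjective L :=
    (LinearMap.injective_iff_surjective_of_finrank_eq_finrank hrk.symm).1 hinj
  obtain ⟨e, rfl⟩ := hsurj v
  exact ⟨e, hL e⟩

omit [FiniteDimensional ℚ V] in
/-- The `ℂ`-linear maps on `ℂ ⊗_ℚ V` are determined by their values on `1 ⊗ V`. [folklore] -/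
theorem linearMap_ext_one_tmul {W : Type*} [AddCommGroup W] [Module ℂ W] {f g : ℂ ⊗[ℚ] V →ₗ[ℂ] W}
    (h : ∀ v : V, f (1 ⊗ₜ v) = g (1 ⊗ₜ v)) : f = g := by
  refine LinearMap.ext fun x ↦ ?_
  induction x using TensorProduct.induction_on with
  | zero => rw [map_zero, map_zero]
  | tmul c v =>
    have hc : c ⊗ₜ[ℚ] v = c • ((1 : ℂ) ⊗ₜ[ℚ] v) := by
      rw [TensorProduct.smul_tmul', smul_eq_mul, mul_one]
    rw [hc, map_smul, map_smul, h v]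
  | add x y hx hy => rw [map_add, map_add, hx, hy]

/-- **Every eigen-coordinate of a non-zero rational vector is non-zero.** With `dim_ℚ V = [K:ℚ]`, an
eigenbasis `ℓ` and `0 ≠ u ∈ V`: `repr (1 ⊗ u) σ ≠ 0` for every `σ` — otherwise the `σ`-coordinate
vanishes on `1 ⊗ ι(e) u` for all `e`, i.e. on `1 ⊗ V`, hence everywhere, contradicting
`repr (ℓ σ) σ = 1`. [cite: Shimura1998, §3.2] -/
theorem repr_one_tmul_ne_zero (hrk : Module.finrank ℚ V = Module.finrank ℚ K)
    (ℓ : Basis (K →+* ℂ) ℂ (ℂ ⊗[ℚ] V)) (hℓ : ∀ σ, ℓ σ ∈ EigLine[ι, σ])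
    {u : V} (hu : u ≠ 0) (σ : K →+* ℂ) : ℓ.repr ((1 : ℂ) ⊗ₜ u) σ ≠ 0 := by
  intro h0
  have hall : ∀ v : V, ℓ.repr ((1 : ℂ) ⊗ₜ v) σ = 0 := by
    intro v
    obtain ⟨e, rfl⟩ := exists_eq_ι_apply ι hrk hu v
    rw [← LinearMap.baseChange_tmul, repr_baseChange_ι_apply ι ℓ hℓ, h0, mul_zero]
  have hzero : ℓ.coord σ = 0 :=
    linearMap_ext_one_tmul fun v ↦ by rw [Basis.coord_apply, hall v, LinearMap.zero_apply]
  have h1 : ℓ.coord σ (ℓ σ) = 1 := by rw [Basis.coord_apply, ℓ.repr_self, Finsupp.single_eq_same]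
  rw [hzero, LinearMap.zero_apply] at h1
  exact zero_ne_one h1

end EigenBasis

end Summit.HodgeConjecture.CorCM.Model

end
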